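import Summits.HodgeConjecture.HodgeConjecture.Theses.MotivatedLefschetzSplit
import Summits.HodgeConjecture.HodgeConjecture.Theses.QbarEnvelope
import Literature.AlgebraicGeometry.HodgeTheory.MotivatedClassesDeformationLeaves
import Literature.AlgebraicGeometry.HodgeTheory.MotivatedClassesAlgebraic
import Literature.AlgebraicGeometry.HodgeTheory.MotivatedClassesProofs
import Literature.AlgebraicGeometry.HodgeTheory.AlgebraicClassesPullbackOfCupProduct
import Literature.AlgebraicGeometry.HodgeTheory.HardLefschetzNFoldHolds
import HarnessLib.Audit

/-!
# Line `motivated_envelope` for crux `HodgeClassesMotivated` (stmt-HodgeConjecture-17488) of route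
`MotivatedLefschetzSplit` — the ℚ̄-ENVELOPE SPLIT `HM ⟸ Envelope ∧ HM/ℚ̄ ∧ André Prop. 2.1 (ii)`

Strategist seat `planner-cstrat-stmt-HodgeConjecture-17488-s1-0` (2026-08-17). An ALTERNATIVE line,
registered next to (never instead of) the live line `Lines/birth.lean` (Tannakian split
`(π₀) ∧ (Lie) ∧ §4.6 (ii)`), whose hardest stub `stub_neutralComponent_le_hodgeGroup`
(`G¹_mot(X)⁰ ≤ Hg(X)`) has no external handle short of HM itself.

The crux (FIXED; the route's decl, rank 2): `HodgeClassesMotivated` (HM, deep middle `2 ≤ p ≤ n/2`):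
every rational `(p,p)`-class on a smooth projective complex `n`-fold lies in André's
`A_motᵖ(X)_ℂ = motivatedClasses n X p` (Y. André, Publ. Math. IHÉS 83 (1996), §2.1 Déf. 1).

## The line (three stubs, two conjecture-grade and HM-necessary, one a theorem in print)

* `stub_envelope` — **(E) the ℚ̄-envelope of a Hodge class**, BY NAME the filed, staffed item
  `QbarEnvelope.Envelope` (stmt-HodgeConjecture-1069, shared): every rational `(p,p)`-class `c` on a
  smooth projective complex `X` is `ι^* c'` for a morphism `ι : X ⟶ W` into a smooth projective `W`
  DEFINABLE OVER A NUMBER FIELD and a rational `(p,p)`-class `c'` on `W`. On paper `(E) ⟸ HC`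
  (Voisin, *Hodge loci and absolute Hodge classes*, Compos. Math. 143 (2007), Prop. 1.2/1.7 and
  Thm. 0.5/0.6; Charles–Schnell, *Notes on absolute Hodge classes* (2014) §11.3.19: a Hodge-locus
  component through `(X, c)` is defined over `ℚ̄` as soon as `c` is absolute Hodge, and spreading `c`
  over a resolution `W` of the universal family over that component gives `c = ι^* c'`); and
  `(E) ⟸ HM` as well (motivated ⇒ absolute Hodge, André §2.5 Scolie; then the same argument). Its
  own registered line `Cruxes/…/QbarEnvelope` births (E) from `T ∧ C ∧ D ∧ N` (Voisin Thm 0.5 (2),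
  CDK algebraicity, Deligne's "defined over ℚ̄" criterion, resolution) — all the Hodge-locus /
  spreading-out machinery lives THERE, not in this skeleton.
* `stub_hodgeClassesMotivatedOverNumberFields` — **(HM/ℚ̄) HM for varieties definable over a
  number field, all `p`** (NEW atom on the real carriers; verbatim the binders of
  `QbarEnvelope.HCOverNumberFields` = stmt-HodgeConjecture-1070 with the conclusion
  `algebraicClasses` replaced by `motivatedClasses`). Strictly between HC/ℚ̄ (stmt-1070; tree glue
  `…_of_hcOverNumberFields` below) and nothing: implied by HM trivially, by HC/ℚ̄ via
  `algebraic ⊆ motivated`; a THEOREM on the sector where HC/ℚ̄ is hardest (abelian varieties incl.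
  CM/Weil type: André Thm. 0.6.2 = tree fact `Andre1996_hodgeClasses_abelianVariety_motivated`, no
  definability needed); and exactly the real-carrier shadow of the PeriodsPolice cruxes
  `PeriodsPoliceHodgeClasses` (stmt-14650) ∧ `CompactCommutantTrivial` (stmt-14651), which conclude
  `Hdgᵖ(Y) ≤ A_motᵖ(Y)` for ℚ̄-definable `Y` on the abstract `PeriodRealization` carrier under
  André's motivated period conjecture (Andre2004 ch. 7, §7.5–7.6; Bost–Charles arXiv:1307.1045 §5) —
  a conditional handle that exists ONLY over `ℚ̄`, which is the why-easier of this stub.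
* `stub_motivatedPullback` — **André 1996 Prop. 2.1 (ii)** BY NAME the Literature fact
  `Andre1996_motivatedClasses_pullback` (p. 15: "`A•_mot(X)` a une structure naturelle de
  `E`-algèbre graduée … et, pour tout morphisme `f : Y → X`, `f^*` envoie `A•_mot(X)` dans
  `A•_mot(Y)`"): pull-back along ANY morphism of smooth projective complex varieties preserves
  motivated classes. A theorem in print; in the tree it is reduced to Voisin II Prop. 9.20
  (`Voisin2003_cupProduct_algebraicClasses` ⟸ `Roberts1972_genericProjection`, shared with this
  route's support item `DiagonalPullbackAlgebraic` stmt-17490) and Lemme 1.3.2 for `pr₁^*`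
  (`Summit…Theorems.andreMotivatedPullback_of_cupProduct_of_mapFst`); and INSIDE THIS ROUTE it is
  outright implied by the route's other items `LefschetzStandardB ∧ DiagonalPullbackAlgebraic`
  (glue `…_of_lefschetzStandardB_of_diagonalPullback` below, kernel-checked) — so the line adds no
  theorem-grade debt to the route's `closes`.

Composition `HodgeClassesMotivated_of : (E) → (HM/ℚ̄) → (2.1 ii) → HodgeClassesMotivated` (real
proof, 4 lines): given `c`, take `(W, ι, c')` from (E); `c' ∈ A_motᵖ(W)` by (HM/ℚ̄); `c = ι^* c' ∈
A_motᵖ(X)` by (2.1 ii). The deep-middle guards `2 ≤ p`, `2p ≤ n` of the crux are not used (the line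
proves HM in all bidegrees, as HM ⟸ HC does).

Why it dodges the live line's stuck goal (`neutralComponent (specialMotivatedGaloisGroup n X) ≤
hodgeGroup n X`, no handle but HM): no motivated Galois group, no connectedness, no Lie algebra; the
transcendental variety `X` is touched only through ONE morphism `ι` to a ℚ̄-variety, and all
conjectural content sits over `ℚ̄` (HM/ℚ̄) or in the already-filed envelope item (E).

[cite: Andre1996Motifs, §2.1 Déf. 1 and Prop. 2.1 (ii) (pp. 14–15), §2.5 Scolie (p. 18), Thm. 0.6.2 (p. 6)]
[cite: Voisin2007HodgeLoci, Thm. 0.5, 0.6, Prop. 1.2, 1.7] [cite: CharlesSchnell2014Notes, §11.3.19]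
[cite: Andre2004, ch. 7 §7.5–7.6] [cite: BostCharles2014, §5]
-/

set_option linter.dupNamespace false

noncomputable section

open CategoryTheory MonoidalCategory CartesianMonoidalCategory
open Literature.AlgebraicGeometry Literature.AlgebraicGeometry.Motives
  Literature.AlgebraicGeometry.HodgeTheory

namespace Summit.HodgeConjecture.HodgeConjecture.Cruxes.HodgeClassesMotivated.MotivatedEnvelope

open Summit.HodgeConjecture.HodgeConjecture.Theses
open Summit.HodgeConjecture.HodgeConjecture.Theses.MotivatedLefschetzSplit

/-! ### The three registered stubs -/

/-- **Stub (E) — the ℚ̄-envelope of a Hodge class**, by name the filed shared item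
`QbarEnvelope.Envelope` (stmt-HodgeConjecture-1069): every rational `(p,p)`-class on a smooth
projective complex variety is the pull-back, along a morphism to a smooth projective variety
definable over a number field, of a rational `(p,p)`-class there. Conjecture-grade; implied by HC and
by HM on paper (Voisin 2007 Prop. 1.2/1.7 + Thm. 0.5; André §2.5 Scolie); its own birth line
`Cruxes/…/QbarEnvelope` derives it from `T ∧ C ∧ D ∧ N`.
[cite: Voisin2007HodgeLoci, Thm. 0.5 (2), Prop. 1.2, Prop. 1.7] [cite: CharlesSchnell2014Notes, §11.3.19] -/
theorem stub_envelope : QbarEnvelope.Envelope := by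
  sorry

/-- **Stub (HM/ℚ̄) — Hodge classes are motivated on varieties definable over a number field** (all
bidegrees): for `X` smooth projective complex of dimension `n`, isomorphic to the base change along
some `σ : K →+* ℂ` of a `K`-scheme `X₀`, `K` a number field, every rational class of Hodge type
`(p,p)` in `H²ᵖ(X(ℂ); ℂ)` lies in `motivatedClasses n X p`. The binders are verbatim those of
`QbarEnvelope.HCOverNumberFields` (stmt-HodgeConjecture-1070), the conclusion André's Déf. 1 instead
of `algebraicClasses`. OPEN; a theorem for abelian varieties (Thm. 0.6.2) and abelian-motivated
varieties; conditional on André's motivated period conjecture via the PeriodsPolice cruxes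
stmt-14650/14651 (abstract carrier). [cite: Andre1996Motifs, §2.1 Déf. 1 (p. 14), Thm. 0.6.2 (p. 6)]
[cite: Andre2004, ch. 7 §7.5–7.6] -/
theorem stub_hodgeClassesMotivatedOverNumberFields :
    ∀ ⦃n : ℕ⦄ ⦃X : SchemeOver ℂ⦄, IsSmoothProjective n X →
      (∃ (K : Type) (_ : Field K) (_ : NumberField K) (σ : K →+* ℂ) (X₀ : SchemeOver K),
          Nonempty (X ≅ (baseChangeHom σ).obj X₀)) →
        ∀ (p : ℕ) (c : complexBetti X (2 * p)), IsRationalClass c →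
          IsOfHodgeType n X (2 * p) p p c → c ∈ motivatedClasses n X p := by
  sorry

/-- **Stub (2.1 ii) — pull-back preserves motivated classes**, by name the Literature fact
`Andre1996_motivatedClasses_pullback` (André 1996 Prop. 2.1 (ii), p. 15; a theorem in print, in the
tree reduced to Voisin II Prop. 9.20 + Lemme 1.3.2 by
`Theorems.andreMotivatedPullback_of_cupProduct_of_mapFst`, and implied inside this route by
`LefschetzStandardB ∧ DiagonalPullbackAlgebraic`, see the glue below).
[cite: Andre1996Motifs, Prop. 2.1 (ii) (p. 15)] [cite: VoisinHodgeII2003, Prop. 9.20, Prop. 9.21 (i)] -/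
theorem stub_motivatedPullback : Andre1996_motivatedClasses_pullback := by
  sorry

/-! ### The composition (real proof) -/

/-- **(E) → (HM/ℚ̄) → (2.1 ii) → `HodgeClassesMotivated`.** Given a rational `(p,p)`-class `c` on
`X`, write `c = ι^* c'` with `ι : X ⟶ W`, `W` definable over a number field, `c'` rational `(p,p)` on
`W` (E); then `c' ∈ A_motᵖ(W)` (HM/ℚ̄) and `c = ι^* c' ∈ A_motᵖ(X)` (2.1 ii).
[cite: Andre1996Motifs, Prop. 2.1 (ii) (p. 15)] [cite: Voisin2007HodgeLoci, Prop. 1.7] -/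
theorem HodgeClassesMotivated_of (hE : type_of% stub_envelope)
    (hQ : type_of% stub_hodgeClassesMotivatedOverNumberFields)
    (hP : type_of% stub_motivatedPullback) :
    Summit.HodgeConjecture.HodgeConjecture.Theses.MotivatedLefschetzSplit.HodgeClassesMotivated := by
  intro n X hX p _ _ c hc hpp
  obtain ⟨m, W, ι, c', hW, hWdef, hc', hc'pp, hιc⟩ := hE hX p c hc hpp
  rw [← hιc]
  exact hP ι hW hX p c' (hQ hW hWdef p c' hc' hc'pp)

/-- The same composition with the three stub statements spelled out (no `type_of%`).
[cite: Andre1996Motifs, Prop. 2.1 (ii) (p. 15)] -/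
theorem hodgeClassesMotivated_of_spelled :
    QbarEnvelope.Envelope →
    (∀ ⦃n : ℕ⦄ ⦃X : SchemeOver ℂ⦄, IsSmoothProjective n X →
      (∃ (K : Type) (_ : Field K) (_ : NumberField K) (σ : K →+* ℂ) (X₀ : SchemeOver K),
          Nonempty (X ≅ (baseChangeHom σ).obj X₀)) →
        ∀ (p : ℕ) (c : complexBetti X (2 * p)), IsRationalClass c →
          IsOfHodgeType n X (2 * p) p p c → c ∈ motivatedClasses n X p) →
    Andre1996_motivatedClasses_pullback →
    Summit.HodgeConjecture.HodgeConjecture.Theses.MotivatedLefschetzSplit.HodgeClassesMotivated :=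
  fun hE hQ hP ↦ HodgeClassesMotivated_of hE hQ hP

/-- The registered stubs compose to the crux (depends on the three `stub_*` and nothing else
unproved). [cite: Andre1996Motifs, Prop. 2.1 (ii) (p. 15)] -/
theorem hodgeClassesMotivated_of_stubs :
    Summit.HodgeConjecture.HodgeConjecture.Theses.MotivatedLefschetzSplit.HodgeClassesMotivated :=
  HodgeClassesMotivated_of stub_envelope stub_hodgeClassesMotivatedOverNumberFields
    stub_motivatedPullback

/-- Alias in the skeleton checker's `<Crux>_proof` spelling. [cite: Andre1996Motifs, Prop. 2.1 (ii) (p. 15)] -/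
theorem HodgeClassesMotivated_proof :
    Summit.HodgeConjecture.HodgeConjecture.Theses.MotivatedLefschetzSplit.HodgeClassesMotivated :=
  hodgeClassesMotivated_of_stubs

/-! ### Proved glue: where the stubs sit under items already on the ledger -/

/-- **(HM/ℚ̄) ⟸ HC/ℚ̄** (`QbarEnvelope.HCOverNumberFields`, stmt-HodgeConjecture-1070): algebraic
classes are motivated (`algebraicClasses_le_motivatedClasses_of_nonempty_hardLefschetzNFold`, with the
tree theorem `nonempty_hardLefschetzNFold_holds`). So the new stub is at most as strong as the filed
HC/ℚ̄ item, and the whole line at most as strong as route `QbarEnvelope`'s `Envelope ∧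
HCOverNumberFields`. [cite: Andre1996Motifs, §2.1 remark following Déf. 1 (p. 14)] -/
theorem stub_hodgeClassesMotivatedOverNumberFields_of_hcOverNumberFields
    (h : QbarEnvelope.HCOverNumberFields) :
    type_of% stub_hodgeClassesMotivatedOverNumberFields := by
  intro n X hX hdef p c hc hpp
  exact algebraicClasses_le_motivatedClasses_of_nonempty_hardLefschetzNFold hX
    (nonempty_hardLefschetzNFold_holds (n + n) (X ⊗ X)) p ((h hX hdef).2 p c hc hpp)

/-- **(2.1 ii) ⟸ `LefschetzStandardB ∧ DiagonalPullbackAlgebraic`** (the route's items stmt-17489,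
stmt-17490): under `B` and the diagonal pull-back property, motivated classes are algebraic
(`motivatedClasses_le_algebraicClasses_of_standardConjectureB_of_map_diagonal`), algebraic classes
pull back along every morphism (Fulton Cor. 19.2 (b) from Voisin II Prop. 9.20,
`fulton1998_map_mem_algebraicClasses_of_cupProduct` with
`cupProduct_mem_algebraicClasses_of_forall_map_diagonal`), and algebraic classes are motivated. Hence
inside route `MotivatedLefschetzSplit` the stub (2.1 ii) is absorbed by binders `closes` already has.
[cite: Andre1996Motifs, §2.1 remark following Déf. 1 (p. 14), Prop. 2.1 (ii) (p. 15)]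
[cite: VoisinHodgeII2003, Prop. 9.20, Prop. 9.21 (i)] [cite: Fulton1998, Cor. 19.2 (b)] -/
theorem stub_motivatedPullback_of_lefschetzStandardB_of_diagonalPullback
    (hB : LefschetzStandardB) (hΔ : DiagonalPullbackAlgebraic) :
    type_of% stub_motivatedPullback := by
  intro m n W X j hW hX p c' hc'
  have hcup : Voisin2003_cupProduct_algebraicClasses := fun _ _ hV a b _ _ hx hy ↦
    cupProduct_mem_algebraicClasses_of_forall_map_diagonal hΔ hV a b hx hy
  have hA : c' ∈ algebraicClasses W p :=
    motivatedClasses_le_algebraicClasses_of_standardConjectureB_of_map_diagonal hΔ hB hW p hc'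
  exact algebraicClasses_le_motivatedClasses_of_nonempty_hardLefschetzNFold hX
    (nonempty_hardLefschetzNFold_holds (n + n) (X ⊗ X)) p
    (fulton1998_map_mem_algebraicClasses_of_cupProduct hcup j hW hX p c' hA)

/-- **Net content of the line for the route**: with the route's own items `B` and `Δ` in hand,
`Envelope ∧ HM/ℚ̄ ⟹ HodgeClassesMotivated`. [cite: Andre1996Motifs, Prop. 2.1 (ii) (p. 15)] -/
theorem hodgeClassesMotivated_of_envelope_of_overNumberFields
    (hB : LefschetzStandardB) (hΔ : DiagonalPullbackAlgebraic) (hE : type_of% stub_envelope)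
    (hQ : type_of% stub_hodgeClassesMotivatedOverNumberFields) :
    Summit.HodgeConjecture.HodgeConjecture.Theses.MotivatedLefschetzSplit.HodgeClassesMotivated :=
  HodgeClassesMotivated_of hE hQ
    (stub_motivatedPullback_of_lefschetzStandardB_of_diagonalPullback hB hΔ)

/-- **Upper bound of the line by route `QbarEnvelope`'s conjunction**: `Envelope ∧ HCOverNumberFields
∧ (2.1 ii) ⟹ HodgeClassesMotivated`. [cite: Andre1996Motifs, Prop. 2.1 (ii) (p. 15)] -/
theorem hodgeClassesMotivated_of_envelope_of_hcOverNumberFields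
    (hE : QbarEnvelope.Envelope) (hHC : QbarEnvelope.HCOverNumberFields)
    (hP : Andre1996_motivatedClasses_pullback) :
    Summit.HodgeConjecture.HodgeConjecture.Theses.MotivatedLefschetzSplit.HodgeClassesMotivated :=
  HodgeClassesMotivated_of hE (stub_hodgeClassesMotivatedOverNumberFields_of_hcOverNumberFields hHC) hP

end Summit.HodgeConjecture.HodgeConjecture.Cruxes.HodgeClassesMotivated.MotivatedEnvelope

end
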